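import Summits.HubbardSuperconductivity.HubbardSuperconductivity.Theorems.KacWindowPenaltyWindowGapPenalisedForms
import Summits.HubbardSuperconductivity.HubbardSuperconductivity.Theorems.KacWindowPenaltyGlue
import Summits.HubbardSuperconductivity.HubbardSuperconductivity.Theorems.KacWindowPenaltyWindowGapSummitSplit
import Literature.MathematicalPhysics.QuantumLattice.HubbardTorusFlux

/-!
# Crux `WindowGap` (stmt-HubbardSuperconductivity-1088) — strategist census v2 (gen 1, seat s1), TYPED attempts

Companion of `Cruxes/WindowGap/STRATEGY-CENSUS.md` v2 (seat
planner-cstrat-stmt-HubbardSuperconductivity-1088-s1-0, 2026-08-17). It extends, and does not replace,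
`Cruxes/WindowGap/SketchStrategist.lean` (gen 0, seat p1). No `sorry`; nothing here is a line.

What is NEW and kernel-checked here (census §Decomposition D7, §Strengthen S7/S9, §Transfer T6):

* `FloorAt U δ` — the EVERY-GROUND-STATE WINDOW FLOOR at `(U, δ)`: `∀ C ≥ 0 ∀ ε₀ > 0 ∃ ε ≤ ε₀ ∃ a > 0 ∃ L₀`,
  every normalised `(N_L, S^z = 0)` ground state `ψ` of the PURE torus at every even `L ≥ L₀` has window
  pair weight `(Cε + a) L² ≤ Re ⟨ψ, W_ε ψ⟩`. It is the necessary consequence of the crux body (`floorAt_of_gapAt`,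
  the route's sandwich) — and it is ALL the route consumes of the crux:
  `hubbardSuperconductivity_of_windowFloor_of_wib : WindowFloor → WindowInfraredBound → HubbardSuperconductivity`
  (floor + tail bound ⇒ every-GS `d`-wave LRO ⇒ summit), where `WindowFloor := ∃ U > 0, δ ∈ (0,1/2), FloorAt U δ`.
* `WindowRobustness` (`∀ U δ, FloorAt U δ → GapAt U δ`, the stiffness bridge) and the glue
  `windowGap_of_windowFloor_of_robust : WindowFloor → WindowRobustness → WindowGap` — the typed split D7.
* `floorAt_of_everyGSOrder` — every-GS LRO at `(U, δ)` (≡ the summit's matrix at `(U, δ)`,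
  `summitMatrix_iff_everyGSOrder`) implies `FloorAt U δ`; with `everyGSOrder_of_floorAt_of_wibAt` this gives
  `floorAt_iff_everyGSOrder_of_wibAt`: GIVEN the sibling crux's body at the point, the floor IS the summit at the
  point. Hence (census D7): given crux 3 at `(U, δ)`, `WindowGap-at-(U,δ) ⇔ Summit-at-(U,δ) ∧ Robustness-at-(U,δ)`,
  and the route's `closes` never consumes the second conjunct.
* `TwoRegimeProfile` (S7) and `HelicityFloor` (T6/S9) are typed strengthen/transfer targets discussed in the
  census; no implication to or from the crux is claimed for `HelicityFloor` (none is provable by known tools).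
-/

set_option linter.dupNamespace false

namespace Summit.HubbardSuperconductivity.HubbardSuperconductivity.Cruxes.WindowGap.StrategistS1

open Matrix Literature.MathematicalPhysics.QuantumLattice Literature.Probability.LatticeModels
open Summit.HubbardSuperconductivity.HubbardSuperconductivity.Theses.KacWindowPenalty
  (WindowGap WindowInfraredBound)
open Summit.HubbardSuperconductivity.HubbardSuperconductivity.Theorems
open Summit.HubbardSuperconductivity.TwTipContinuation.Negative
  (summitMatrix_of_everyGSOrder summitMatrix_iff_everyGSOrder)

noncomputable section

/-- The summit filling `N_L = 2⌊(1−δ)L²/2⌋`. -/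
abbrev Nfill (δ : ℝ) (L : ℕ) : ℕ := 2 * ⌊(1 - δ) * (L : ℝ) ^ 2 / 2⌋₊

/-- The crux's literal Kac-window pair penalty `W_ε = L⁻² Σ_{|q_m| ≤ ε} Δ_d(m)ᴴ Δ_d(m)` (an `abbrev`, so that
the landed lemmas, all stated with the explicit sum, apply by `exact`). -/
abbrev kacW (L : ℕ) [NeZero L] (ε : ℝ) :
    Matrix (Finset (Orb (FermionTorus 2 L))) (Finset (Orb (FermionTorus 2 L))) ℂ :=
  ∑ m : Fin 2 → ZMod L,
    if (2 * Real.pi / (L : ℝ)) ^ 2 * (∑ i : Fin 2, (((m i).valMinAbs : ℤ) : ℝ) ^ 2) ≤ ε ^ 2 then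
      ((L : ℂ) ^ 2)⁻¹ • (Matrix.conjTranspose (pairFieldAt dWaveFormFactor L m) *
        pairFieldAt dWaveFormFactor L m)
    else 0

/-- The window tail `T_ε(ψ) = L⁻² Σ_{m ≠ 0, |q_m| ≤ ε} ‖Δ_d(m) ψ‖²` (literal summand of the route). -/
abbrev windowTail (L : ℕ) [NeZero L] (ε : ℝ) (ψ : Fock (Orb (FermionTorus 2 L))) : ℝ :=
  ∑ m : Fin 2 → ZMod L,
    if m ≠ 0 ∧ (2 * Real.pi / (L : ℝ)) ^ 2 * (∑ i : Fin 2, (((m i).valMinAbs : ℤ) : ℝ) ^ 2) ≤ ε ^ 2 then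
      (star (Matrix.mulVec (pairFieldAt dWaveFormFactor L m) ψ) ⬝ᵥ
          Matrix.mulVec (pairFieldAt dWaveFormFactor L m) ψ).re / (L : ℝ) ^ 2
    else 0

/-! ## The four point-bodies -/

/-- Body of the crux `WindowGap` at a point `(U, δ)`. -/
def GapAt (U δ : ℝ) : Prop :=
  ∀ C : ℝ, 0 ≤ C → ∀ ε₀ : ℝ, 0 < ε₀ → ∃ ε ∈ Set.Ioc (0 : ℝ) ε₀, ∃ lam a : ℝ, 0 < lam ∧ 0 < a ∧
    ∃ L₀ : ℕ, ∀ (L : ℕ) [NeZero L], L₀ ≤ L → Even L →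
      lam * (C * ε + a) * (L : ℝ) ^ 2 ≤
        (hubbardTorus 2 L 1 U + (lam : ℂ) • kacW L ε).minEnergyOn (szSector (Nfill δ L) 0) -
          (hubbardTorus 2 L 1 U).minEnergyOn (szSector (Nfill δ L) 0)

/-- **The every-ground-state WINDOW FLOOR at `(U, δ)`** (census D7, piece 1 at a point): for every tail
allowance `C` and every `ε₀` some window radius `ε ≤ ε₀`, order constant `a > 0` and threshold make EVERY
normalised sector ground state of the pure torus carry window pair weight `(Cε + a)L² ≤ Re ⟨ψ, W_ε ψ⟩`. No
penalty, no `λ`: the twist ceiling / margin decay / penalty-budget box of the crux do not concern it. -/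
def FloorAt (U δ : ℝ) : Prop :=
  ∀ C : ℝ, 0 ≤ C → ∀ ε₀ : ℝ, 0 < ε₀ → ∃ ε ∈ Set.Ioc (0 : ℝ) ε₀, ∃ a : ℝ, 0 < a ∧
    ∃ L₀ : ℕ, ∀ (L : ℕ) [NeZero L], L₀ ≤ L → Even L →
      ∀ ψ : Fock (Orb (FermionTorus 2 L)), star ψ ⬝ᵥ ψ = 1 →
        IsGroundStateInSector (hubbardTorus 2 L 1 U) (Nfill δ L) 0 ψ →
          (C * ε + a) * (L : ℝ) ^ 2 ≤ (star ψ ⬝ᵥ kacW L ε *ᵥ ψ).re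

/-- Body of the sibling crux `WindowInfraredBound` at a point `(U, δ)` (window tail `≤ C ε L²`). -/
def WibAt (U δ : ℝ) : Prop :=
  ∃ C ε₀ : ℝ, 0 ≤ C ∧ 0 < ε₀ ∧ ∃ L₀ : ℕ, ∀ ε ∈ Set.Ioc (0 : ℝ) ε₀, ∀ (L : ℕ) [NeZero L], L₀ ≤ L →
    Even L → ∀ ψ : Fock (Orb (FermionTorus 2 L)), star ψ ⬝ᵥ ψ = 1 →
      IsGroundStateInSector (hubbardTorus 2 L 1 U) (Nfill δ L) 0 ψ →
        windowTail L ε ψ ≤ C * ε * (L : ℝ) ^ 2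

/-- Every-ground-state `d`-wave pair long-range order at `(U, δ)` (the hypothesis shape of
`summitMatrix_of_everyGSOrder`; ≡ the summit's matrix at `(U, δ)` by `summitMatrix_iff_everyGSOrder`). -/
def EveryGSOrderAt (U δ : ℝ) : Prop :=
  ∃ c : ℝ, 0 < c ∧ ∃ L₀ : ℕ, ∀ (L : ℕ) [NeZero L], L₀ ≤ L → Even L →
    ∀ ψ : Fock (Orb (FermionTorus 2 L)), star ψ ⬝ᵥ ψ = 1 →
      IsGroundStateInSector (hubbardTorus 2 L 1 U) (Nfill δ L) 0 ψ →
        c * (L : ℝ) ^ 4 ≤ (expect ((pairField dWaveFormFactor L)ᴴ * pairField dWaveFormFactor L) ψ).re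

/-- The crux is, verbatim, `∃ (U, δ), GapAt U δ` (the route's `let D` / `let W` are `pairFieldAt` /
`kacW` by `rfl`). -/
theorem windowGap_iff : WindowGap ↔ ∃ U : ℝ, 0 < U ∧ ∃ δ ∈ Set.Ioo (0 : ℝ) (1 / 2), GapAt U δ :=
  Iff.rfl

/-- The sibling crux is, verbatim, `∀ (U, δ), WibAt U δ`. -/
theorem windowInfraredBound_iff :
    WindowInfraredBound ↔ ∀ U : ℝ, 0 < U → ∀ δ ∈ Set.Ioo (0 : ℝ) (1 / 2), WibAt U δ :=
  Iff.rfl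

/-! ## D7, piece 1 is NECESSARY: crux body ⇒ floor (the sandwich) -/

/-- **Gap at `(U, δ)` ⇒ floor at `(U, δ)`** — the route's sandwich `gap ≤ λ Re ⟨ψ₀, W_ε ψ₀⟩`, isolated
(`windowWeight_of_windowGapAt`, p98536). [folklore] -/
theorem floorAt_of_gapAt {U δ : ℝ} (h : GapAt U δ) : FloorAt U δ := by
  intro C hC ε₀ hε₀
  obtain ⟨ε, hε, lam, a, hlam, ha, L₀, hG⟩ := h C hC ε₀ hε₀
  refine ⟨ε, hε, a, ha, L₀, fun L _ hL hE ψ hψ hgs => ?_⟩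
  have hgap := hG L hL hE
  have hgap' : lam * ((C * ε + a) * (L : ℝ) ^ 2) ≤
      (hubbardTorus 2 L 1 U + (lam : ℂ) • kacW L ε).minEnergyOn (szSector (Nfill δ L) 0) -
        (hubbardTorus 2 L 1 U).minEnergyOn (szSector (Nfill δ L) 0) := by
    calc lam * ((C * ε + a) * (L : ℝ) ^ 2) = lam * (C * ε + a) * (L : ℝ) ^ 2 := by ring
      _ ≤ _ := hgap
  exact windowWeight_of_windowGapAt L U (Nfill δ L) hlam hgap' hψ hgs

/-- `WindowFloor := ∃ U > 0, δ ∈ (0, 1/2), FloorAt U δ` — the `wuc` form of the crux (census D7). -/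
def WindowFloor : Prop :=
  ∃ U : ℝ, 0 < U ∧ ∃ δ ∈ Set.Ioo (0 : ℝ) (1 / 2), FloorAt U δ

/-- **The crux implies its floor** (`WindowGap → WindowFloor`). [folklore] -/
theorem windowFloor_of_windowGap (h : WindowGap) : WindowFloor := by
  obtain ⟨U, hU, δ, hδ, hG⟩ := (windowGap_iff).1 h
  exact ⟨U, hU, δ, hδ, floorAt_of_gapAt hG⟩

/-! ## D7, the split: FLOOR ∧ ROBUSTNESS ⇒ crux -/

/-- **Piece 2 (the stiffness bridge):** wherever every ground state carries the window floor, a weak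
enough Kac-window repulsion produces the extensive penalised gap. This is exactly what separates the
crux from its floor; the census (§Decomposition D7) explains why it has no supplier and why the route
never consumes it. -/
def WindowRobustness : Prop :=
  ∀ U : ℝ, 0 < U → ∀ δ ∈ Set.Ioo (0 : ℝ) (1 / 2), FloorAt U δ → GapAt U δ

/-- **Glue of the split D7 (kernel-checked): `WindowFloor → WindowRobustness → WindowGap`.** [folklore] -/
theorem windowGap_of_windowFloor_of_robust (h1 : WindowFloor) (h2 : WindowRobustness) : WindowGap := by
  obtain ⟨U, hU, δ, hδ, hF⟩ := h1
  exact (windowGap_iff).2 ⟨U, hU, δ, hδ, h2 U hU δ hδ hF⟩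

/-! ## D7, what the ROUTE consumes: floor + tail at one point ⇒ every-GS LRO ⇒ summit -/

/-- **Floor + window tail bound at the same `(U, δ)` ⇒ every-ground-state `d`-wave LRO at `(U, δ)`.**
Take `(C, ε₀, L₁)` from the tail bound, then `(ε, a, L₀)` from the floor at `(C, ε₀)`; at even
`L ≥ max L₀ L₁`, for every normalised sector ground state `ψ`:
`(Cε + a)L² ≤ Re ⟨ψ, W_ε ψ⟩ = ‖Δ_d(0)ψ‖²/L² + T_ε(ψ)` (`re_dotProduct_kacWindow_mulVec`, split at `m = 0`,
`pairFieldAt_zero`) and `T_ε(ψ) ≤ CεL²`, hence `a L⁴ ≤ Re ⟨ψ, Δ_dᴴ Δ_d ψ⟩`. The penalised energy never enters: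
this is the whole use the route makes of crux `WindowGap`. Scalapino, Phys. Rep. 250 (1995) §2 (2.4). [folklore] -/
theorem everyGSOrder_of_floorAt_of_wibAt {U δ : ℝ} (hF : FloorAt U δ) (hW : WibAt U δ) :
    EveryGSOrderAt U δ := by
  obtain ⟨C, ε₀, hC, hε₀, L₁, hI⟩ := hW
  obtain ⟨ε, hε, a, ha, L₀, hFl⟩ := hF C hC ε₀ hε₀
  refine ⟨a, ha, max L₀ L₁, fun L _ hL hE ψ hψ1 hψ => ?_⟩
  have hLpos : (0 : ℝ) < (L : ℝ) := Nat.cast_pos.2 (Nat.pos_of_ne_zero (NeZero.ne L))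
  have hL2 : (0 : ℝ) < (L : ℝ) ^ 2 := by positivity
  have hfloor := hFl L (le_of_max_le_left hL) hE ψ hψ1 hψ
  have htail : windowTail L ε ψ ≤ C * ε * (L : ℝ) ^ 2 := hI ε hε L (le_of_max_le_right hL) hE ψ hψ1 hψ
  rw [re_dotProduct_kacWindow_mulVec] at hfloor
  -- the zero label lies in the window
  have hw0 : (2 * Real.pi / (L : ℝ)) ^ 2 *
      (∑ i : Fin 2, ((((0 : Fin 2 → ZMod L) i).valMinAbs : ℤ) : ℝ) ^ 2) ≤ ε ^ 2 := by
    have h0 : ∀ i : Fin 2, ((((0 : Fin 2 → ZMod L) i).valMinAbs : ℤ) : ℝ) ^ 2 = 0 := fun i => by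
      rw [Pi.zero_apply, ZMod.valMinAbs_zero, Int.cast_zero, sq, mul_zero]
    rw [Finset.sum_congr rfl fun i _ => h0 i, Finset.sum_const_zero, mul_zero]
    positivity
  rw [sum_ite_eq_add_sum_ite_ne_and _ _ (0 : Fin 2 → ZMod L) hw0, pairFieldAt_zero,
    star_mulVec_dotProduct_mulVec] at hfloor
  change (C * ε + a) * (L : ℝ) ^ 2 ≤
    (expect ((pairField dWaveFormFactor L)ᴴ * pairField dWaveFormFactor L) ψ).re / (L : ℝ) ^ 2 +
      windowTail L ε ψ at hfloor
  set X := (expect ((pairField dWaveFormFactor L)ᴴ * pairField dWaveFormFactor L) ψ).re with hX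
  have h2 : a * (L : ℝ) ^ 2 ≤ X / (L : ℝ) ^ 2 := by nlinarith [hfloor, htail, hε.1]
  rw [le_div_iff₀ hL2] at h2
  calc a * (L : ℝ) ^ 4 = a * (L : ℝ) ^ 2 * (L : ℝ) ^ 2 := by ring
    _ ≤ X := h2

/-- **Floor + tail at one point ⇒ the summit** (`summitMatrix_of_everyGSOrder`, even-side bookkeeping). [folklore] -/
theorem hubbardSuperconductivity_of_floorAt_of_wibAt {U δ : ℝ} (hU : 0 < U)
    (hδ : δ ∈ Set.Ioo (0 : ℝ) (1 / 2)) (hF : FloorAt U δ) (hW : WibAt U δ) :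
    _root_.HubbardSuperconductivity :=
  ⟨U, hU, δ, hδ, summitMatrix_of_everyGSOrder (everyGSOrder_of_floorAt_of_wibAt hF hW)⟩

/-- **The route closes from the FLOOR: `WindowFloor → WindowInfraredBound → HubbardSuperconductivity`.**
Compare the route's certified `closes (hGap : WindowGap) (hIR : WindowInfraredBound) (hTS : TargetImpliesSummit)`:
by `windowFloor_of_windowGap` the present theorem is the same deciding theorem with a WEAKER first binder —
the penalised-energy form of the crux (its ROBUSTNESS / stiffness half) is never used toward the summit.
Census §Decomposition D7 / §Recommendations R1′. [folklore] -/
theorem hubbardSuperconductivity_of_windowFloor_of_wib (hF : WindowFloor) (hI : WindowInfraredBound) :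
    _root_.HubbardSuperconductivity := by
  obtain ⟨U, hU, δ, hδ, hFl⟩ := hF
  exact hubbardSuperconductivity_of_floorAt_of_wibAt hU hδ hFl ((windowInfraredBound_iff).1 hI U hU δ hδ)

/-! ## D7, piece 1 is a CONSEQUENCE of the summit at the point (lens `wuc`) -/

/-- **Every-GS LRO at `(U, δ)` ⇒ floor at `(U, δ)`.** Given the order constant `c`, serve `(C, ε₀)` with
`ε := min ε₀ (c/(2C+1))` (so `Cε ≤ c/2`), `a := c/2`: the window weight dominates its zero mode,
`Re ⟨ψ, W_ε ψ⟩ ≥ Re ⟨ψ, Δ_dᴴ Δ_d ψ⟩ / L² ≥ c L² ≥ (Cε + a) L²`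
(`re_expect_pairField_div_le_re_dotProduct_kacWindow_mulVec`). So the floor is implied by the summit's matrix at
the point (`summitMatrix_iff_everyGSOrder`): it is a consequence of the summit used toward the summit. [folklore] -/
theorem floorAt_of_everyGSOrder {U δ : ℝ} (h : EveryGSOrderAt U δ) : FloorAt U δ := by
  obtain ⟨c, hc, L₀, hL⟩ := h
  intro C hC ε₀ hε₀
  have hden : (0 : ℝ) < 2 * C + 1 := by linarith
  have hq : 0 < c / (2 * C + 1) := div_pos hc hden
  set ε : ℝ := min ε₀ (c / (2 * C + 1)) with hεdef
  have hεpos : 0 < ε := lt_min hε₀ hq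
  have hεε₀ : ε ≤ ε₀ := min_le_left _ _
  have hεq : ε ≤ c / (2 * C + 1) := min_le_right _ _
  have hCε : C * ε ≤ c / 2 := by
    have h1 : C * ε ≤ C * (c / (2 * C + 1)) := mul_le_mul_of_nonneg_left hεq hC
    have h2 : C * (c / (2 * C + 1)) ≤ c / 2 := by
      rw [mul_div_assoc', div_le_div_iff₀ hden two_pos]
      nlinarith
    linarith
  refine ⟨ε, ⟨hεpos, hεε₀⟩, c / 2, half_pos hc, L₀, fun L _ hL₀ hE ψ hψ1 hψ => ?_⟩
  have hLpos : (0 : ℝ) < (L : ℝ) := Nat.cast_pos.2 (Nat.pos_of_ne_zero (NeZero.ne L))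
  have hL2 : (0 : ℝ) < (L : ℝ) ^ 2 := by positivity
  have hlro := hL L hL₀ hE ψ hψ1 hψ
  have hdom := re_expect_pairField_div_le_re_dotProduct_kacWindow_mulVec L ε ψ
  have h1 : c * (L : ℝ) ^ 2 ≤
      (expect ((pairField dWaveFormFactor L)ᴴ * pairField dWaveFormFactor L) ψ).re / (L : ℝ) ^ 2 := by
    rw [le_div_iff₀ hL2]
    calc c * (L : ℝ) ^ 2 * (L : ℝ) ^ 2 = c * (L : ℝ) ^ 4 := by ring
      _ ≤ _ := hlro
  have h2 : (C * ε + c / 2) * (L : ℝ) ^ 2 ≤ c * (L : ℝ) ^ 2 :=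
    mul_le_mul_of_nonneg_right (by linarith) hL2.le
  exact h2.trans (h1.trans hdom)

/-- **Given the sibling's body at the point, FLOOR ⇔ every-GS LRO** (`⇔` the summit's matrix at `(U, δ)` by
`summitMatrix_iff_everyGSOrder`, `δ ≥ −1`). So, modulo crux 3 at the point, the `wuc` piece of D7 is the summit
at the point — neither weaker nor stronger — and `WindowGap = (summit at the point) ∧ (robustness)`. [folklore] -/
theorem floorAt_iff_everyGSOrder_of_wibAt {U δ : ℝ} (hW : WibAt U δ) :
    FloorAt U δ ↔ EveryGSOrderAt U δ :=
  ⟨fun hF => everyGSOrder_of_floorAt_of_wibAt hF hW, floorAt_of_everyGSOrder⟩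

/-- The same with the summit's matrix at `(U, δ)` on the right (`δ ≥ −1`). [folklore] -/
theorem floorAt_iff_summitMatrix_of_wibAt {U δ : ℝ} (hδ : -1 ≤ δ) (hW : WibAt U δ) :
    FloorAt U δ ↔
      (∀ (N : ℕ → ℕ) (ψ : ∀ L, Fock (Orb (FermionTorus 2 L))),
        (∀ L, Even L → N L = 2 * ⌊(1 - δ) * (L : ℝ) ^ 2 / 2⌋₊ ∧ star (ψ L) ⬝ᵥ ψ L = 1 ∧
            IsGroundStateInSector (hubbardTorus 2 L 1 U) (N L) 0 (ψ L)) →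
          HasLongRangeOrder (fun k => halfOpenBox 2 (2 * k))
            (fun k => torusPullback (pairFieldCorr dWaveFormFactor ψ) (2 * k))) := by
  rw [floorAt_iff_everyGSOrder_of_wibAt hW]
  exact (summitMatrix_iff_everyGSOrder hδ).symm

/-! ## Strengthen — S7 (two-regime profile) and the helicity floor (T6 / S9) -/

/-- **S7 — the two-regime (kink) profile.** At some `(U, δ)`: condensate density `m > 0` and window stiffness
`κ > 0` such that for every small `ε` and EVERY `λ ∈ (0, λ₀]` the penalised gap per site is at least
`min (λ m) (κ ε²) − Cε·λ` … stated here in the simplest usable form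
`λ · min m (κ ε² / λ) · L² ≤ gap + λ C ε L²`. It implies the crux (take `λ := κ ε² / m`, `a := m/2`-type
bookkeeping) and is the physically complete statement (the concave profile `g_L(λ) − g_L(0)` up to the level
crossing at `λ_c ≍ κε²/m` where the condensate leaves the window); the census explains why the added plateau
is the stiffness in its purest form and buys no leverage. Typed, not claimed. -/
def TwoRegimeProfile : Prop :=
  ∃ U : ℝ, 0 < U ∧ ∃ δ ∈ Set.Ioo (0 : ℝ) (1 / 2), ∃ m κ lam₀ : ℝ, 0 < m ∧ 0 < κ ∧ 0 < lam₀ ∧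
    ∀ C : ℝ, 0 ≤ C → ∃ ε₁ : ℝ, 0 < ε₁ ∧ ∀ ε ∈ Set.Ioc (0 : ℝ) ε₁, ∀ lam ∈ Set.Ioc (0 : ℝ) lam₀,
      ∃ L₀ : ℕ, ∀ (L : ℕ) [NeZero L], L₀ ≤ L → Even L →
        lam * min m (κ * ε ^ 2 / lam) * (L : ℝ) ^ 2 ≤
          (hubbardTorus 2 L 1 U + (lam : ℂ) • kacW L ε).minEnergyOn (szSector (Nfill δ L) 0) -
            (hubbardTorus 2 L 1 U).minEnergyOn (szSector (Nfill δ L) 0) + lam * (C * ε) * (L : ℝ) ^ 2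

/-- **S7 implies the crux body** (only its small-`λ` corner is used: `λ := min λ₀ (κε²/m)`, `a := m/2`,
`ε ≤ m/(4C+1)` so that `m − Cε ≥ Cε + m/2`). Kernel-checked so that the census statement "S7 is a genuine
strengthening whose extra content is the plateau" is exact. [folklore] -/
theorem gapAt_of_twoRegimeProfile (h : TwoRegimeProfile) :
    ∃ U : ℝ, 0 < U ∧ ∃ δ ∈ Set.Ioo (0 : ℝ) (1 / 2), GapAt U δ := by
  obtain ⟨U, hU, δ, hδ, m, κ, lam₀, hm, hκ, hlam₀, h⟩ := h
  refine ⟨U, hU, δ, hδ, fun C hC ε₀ hε₀ => ?_⟩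
  obtain ⟨ε₁, hε₁, h⟩ := h C hC
  have hden : (0 : ℝ) < 4 * C + 1 := by linarith
  have hq : 0 < m / (4 * C + 1) := div_pos hm hden
  set ε : ℝ := min (min ε₀ ε₁) (m / (4 * C + 1)) with hεdef
  have hεpos : 0 < ε := lt_min (lt_min hε₀ hε₁) hq
  have hεε₀ : ε ≤ ε₀ := (min_le_left _ _).trans (min_le_left _ _)
  have hεε₁ : ε ≤ ε₁ := (min_le_left _ _).trans (min_le_right _ _)
  have hεq : ε ≤ m / (4 * C + 1) := min_le_right _ _
  have hCε : C * ε ≤ m / 4 := by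
    have h1 : C * ε ≤ C * (m / (4 * C + 1)) := mul_le_mul_of_nonneg_left hεq hC
    have h2 : C * (m / (4 * C + 1)) ≤ m / 4 := by
      rw [mul_div_assoc', div_le_div_iff₀ hden (by norm_num : (0:ℝ) < 4)]
      nlinarith
    linarith
  have hκε : 0 < κ * ε ^ 2 / m := div_pos (mul_pos hκ (pow_pos hεpos 2)) hm
  set lam : ℝ := min lam₀ (κ * ε ^ 2 / m) with hlamdef
  have hlam : 0 < lam := lt_min hlam₀ hκε
  have hlamle : lam ≤ lam₀ := min_le_left _ _
  have hlamκ : lam ≤ κ * ε ^ 2 / m := min_le_right _ _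
  obtain ⟨L₀, hL⟩ := h ε ⟨hεpos, hεε₁⟩ lam ⟨hlam, hlamle⟩
  refine ⟨ε, ⟨hεpos, hεε₀⟩, lam, m / 2, hlam, half_pos hm, L₀, fun L _ hL₀ hE => ?_⟩
  have hineq := hL L hL₀ hE
  have hmin : min m (κ * ε ^ 2 / lam) = m := by
    refine min_eq_left ?_
    rw [le_div_iff₀ hlam]
    calc m * lam ≤ m * (κ * ε ^ 2 / m) := mul_le_mul_of_nonneg_left hlamκ hm.le
      _ = κ * ε ^ 2 := by field_simp
  rw [hmin] at hineq
  have hL2 : (0 : ℝ) ≤ (L : ℝ) ^ 2 := by positivity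
  have hkey : lam * (C * ε + m / 2) * (L : ℝ) ^ 2 ≤ lam * m * (L : ℝ) ^ 2 - lam * (C * ε) * (L : ℝ) ^ 2 := by
    have : lam * (C * ε + m / 2) ≤ lam * m - lam * (C * ε) := by nlinarith
    nlinarith
  linarith

/-- **T6 / S9 — helicity (flux) floor: extensive-in-`θ²` stiffness of the sector energy under a seam flux.**
At `(U, δ)`, `fluxEnergy L U δ θ − fluxEnergy L U δ 0 ≥ ρ θ²` for `|θ| ≤ θ₀`, eventually in even `L`
(`fluxEnergy` = `minEnergyOn` of `hubbardTorusFlux` in the summit sector; Scalapino–White–Zhang superfluid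
weight `D_s = 2ρ`, total cost O(1) for θ = O(1), as for the `q = 0` twist of GSCertificate stmt-0407).
In REFLECTION-POSITIVE classical models `Υ ≥ const · m²` is a theorem (census T6, with the citation and its
status); here it is typed only to record that NEITHER direction `HelicityFloor ↔ GapAt` is available: the crux
prices INTEGER windings `≥ εL/2π` (momentum boosts, extensive cost `≍ ρ ε² L²`), the flux floor prices
fractional flux `θ = O(1)` (cost O(1)); passing between them is the `LROForcesLowLyingStates` gap in reverse. -/
def HelicityFloor (U δ : ℝ) : Prop :=
  ∃ ρ θ₀ : ℝ, 0 < ρ ∧ 0 < θ₀ ∧ ∃ L₀ : ℕ, ∀ (L : ℕ) [NeZero L], L₀ ≤ L → Even L →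
    ∀ θ : ℝ, |θ| ≤ θ₀ → ρ * θ ^ 2 ≤ fluxEnergy L U δ θ - fluxEnergy L U δ 0

end

end Summit.HubbardSuperconductivity.HubbardSuperconductivity.Cruxes.WindowGap.StrategistS1
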